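import Summits.BirchSwinnertonDyer.BirchSwinnertonDyer.Theorems.ByReductionTypeAtTwoOrdKatoHalfAtTwoIsoMuFourDescent
import Summits.BirchSwinnertonDyer.BirchSwinnertonDyer.Theorems.ByReductionTypeAtTwoOrdKatoHalfAtTwoIsoRubinTauAtTwo
import HarnessLib

/-!
# Route ByReductionTypeAtTwo, crux `OrdKatoHalfAtTwoIso` (stmt-BirchSwinnertonDyer-19573), line `steinberg-fibre-at-two`
# (skeleton v11), child `OrdKatoIntSurjectiveAtTwo` = CoreA⁺ `CoreTheoremAPosDiscTwo` (stmt-BirchSwinnertonDyer-23967):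
# plan item (P3) of the lead's `STUB-BRIEF-stub_coreA_posDisc.md` — (H-C)⁺, THE TRANSPOSITION PRIME `q ≡ 1 (mod 4)`

Seat `cruxlead-stmt-BirchSwinnertonDyer-19573-w2` (prover WIDTH under the lead cruxlead-19573 g5; HOME
`run/shared/lean/pub/bsd-2adic/`; `--supports` stmt-BirchSwinnertonDyer-23967). THEOREMS ONLY (no definition, no named fact,
no `sorry`, no instance). HONEST FRAMING (cell bsd-2adic): BSD is not proved by any of this; neither the crux nor CoreA⁺ is
proved here.

WHY. On `0 < Δ` the Kolyvagin cocycle of a tame prime `ℓ` has vanishing real component exactly when `4 ∣ ℓ − 1`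
(`…KolyvaginCocycleInvolution.lean` p687675 / `…KolyvaginRealComponent.lean`, lead g5: complex conjugation sits in the coset
`σ^{(ℓ−1)/2} N` and the derivative sum collapses iff `(ℓ−1)/2` is even). So the `0 < Δ` assembly (brief (P4)) needs the
Chebotarev prime of socket 1's Ω1 = (H-C) with ONE MORE conjunct: `4 ∣ ℓ(q) − 1`, i.e. `Frob_q` fixes `√−1`. This file proves
that strengthened (H-C) (inputs: `…MuFourDescent.lean` for `μ₄` and the index-2 descent of the Sah input; p682874 for Rubin's
`τ`):

* §3 `exists_isArithFrobAt_transposition_weilPairingHom_ne_zero_mod_four_of_mem_kerSubgroup` — the (H-C) ENGINE of p681540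
  (`…_of_mem_kerSubgroup`, itself p662346's with complex conjugation ↦ any transposition `τ ∈ ker κ`) run INSIDE
  `Gal(ℚ̄/ℚ(i))`: `τ` fixes `μ₄`; the auxiliary groups `G = ker ρ̄₂ ⊓ Gal(ℚ̄/ℚ_n)` and `N` are cut down by `Gal(ℚ̄/ℚ(i))`
  (open, normal); joint values come from the index-2 descent; Chebotarev (`exists_isArithFrobAt_mul_inv_mem_not_mem`) then
  gives `Fr = ν a τ` with `ν, a, τ ∈ Gal(ℚ̄/ℚ(i))`. Output = p681540's five conjuncts PLUS `Fr ∈ rootsOfUnityFixer ℚ 4`.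
* §4 `chebotarevTransposition_two_posDisc` — **(H-C)⁺**: the displayed statement `ChebotarevTranspositionTwo`
  (`…OmegaRoadDefs` §2) with `W.Δ < 0` REPLACED by `W.HasGoodReductionAtPrime 2 → 0 < W.Δ` and the EXTRA OUTPUT CONJUNCT
  `4 ∣ ((primesEquiv q : Nat.Primes) : ℕ) - 1` (placed right after `Fr ∈ κ.layerSubgroup n`). Rubin's `τ` (p682874
  `exists_mem_kerSubgroup_transposition_smul_sqrt_neg_one_eq`: `τ ∈ ker κ`, transposition on `E[2]`, `τ • i = i`) needs
  `2Δ, −Δ, −2Δ ∉ ℚ^{×2}` — automatic from good reduction at `2` (`not_isSquare_two_mul_Δ_of_good_two`) and `0 < Δ`; `q ∤ 2`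
  by enlarging `S` with the primes above `2`. This is the binder shape the `0 < Δ` twin of (H-K) `KolyvaginRankOneTwo`
  consumes (hypothesis `4 ∣ ℓ(q) − 1` on its prime `q`).

References: B. Mazur, K. Rubin, Mem. AMS 799 (2004) §3.6, Prop. 1.3.2 [MazurRubin2004]; K. Rubin, *Euler Systems* (2000)
§2.1 `Hyp(K_∞, T)` (b), §4.4 [Rubin2000]; J. Tate, in Cassels–Fröhlich (1967) VII §2.4 [TateGCFT1967]; L. C. Washington (1997)
§13.1 [Washington1997]; tree p681540, p682874, p662346, p661914 (`…HCEngine`).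
-/

set_option autoImplicit false
set_option linter.dupNamespace false

noncomputable section

open scoped NumberField
open Field WeierstrassCurve Function IsDedekindDomain NumberField
open Literature.NumberTheory.EllipticCurves Literature.NumberTheory.GaloisRepresentations
open Literature.NumberTheory.EllipticCurves.DokchitserDokchitser2012
open Summit.BirchSwinnertonDyer.BirchSwinnertonDyer.Rank1Residual
open Rat.HeightOneSpectrum

-- D-0017: single-problem summit, so `Summit.BirchSwinnertonDyer.BirchSwinnertonDyer.…` repeats a namespace BY DESIGN.
namespace Summit.BirchSwinnertonDyer.BirchSwinnertonDyer.Theorems.SteinbergFibreAtTwo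

/-- A transposition of three letters is an involution. [folklore] -/
private theorem perm_fin_three_mul_self_of_sign_eq_neg_one' :
    ∀ g : Equiv.Perm (Fin 3), Equiv.Perm.sign g = -1 → g * g = 1 := by
  decide

/-! ## §3 The (H-C) engine inside `Gal(ℚ̄/ℚ(i))` -/

section Main

variable (W : WeierstrassCurve ℚ) [W.IsElliptic] (κ : ZpExtension ℚ 2)

/-- **(H-C) on the bottom cocycles from a transposition `τ ∈ ker κ` FIXING `μ₄`, with the Frobenius in `Gal(ℚ̄/ℚ(i))`.**
For `ρ̄_{E,2}` onto, `τ ∈ ker κ ⊓ rootsOfUnityFixer ℚ 4` odd on `{T₀, T₁, T₂}`, two continuous `1`-cocycles `φ₀`, `ψ₀`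
of `E[2]` not vanishing on `ker ρ̄₂ ⊓ ker κ`, an alternating non-degenerate pairing `e` on `E[2]`, a finite set `S` and
`n : ℕ`: there is `q ∉ S` with a Frobenius `Fr` above it which is a transposition on `E[2]`, lies in `Gal(ℚ̄/ℚ_n)` AND in
`Gal(ℚ̄/ℚ(i))`, and has `e((Fr − 1)φ₀(Fr), ψ₀(Fr)) ≠ 1`. Proof = p681540's engine with `G`, `N` cut down by the open normal
subgroup `Gal(ℚ̄/ℚ(i))` and the joint values supplied by the index-2 descent (§2).
[cite: MazurRubin2004, §3.6 and Prop. 1.3.2] [cite: TateGCFT1967, §2.4 (Tchebotarev density theorem) with Prop. 2.3] -/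
theorem exists_isArithFrobAt_transposition_weilPairingHom_ne_zero_mod_four_of_mem_kerSubgroup
    (h2 : W.HasSurjectiveModNGaloisRep 2) {τ : absoluteGaloisGroup ℚ} (hτκ : τ ∈ κ.kerSubgroup)
    (hsign : Equiv.Perm.sign (permGal W (two_ne_zero : (2 : ℚ) ≠ 0) τ) = -1)
    (hτ4 : τ ∈ rootsOfUnityFixer ℚ 4)
    (φ₀ ψ₀ : contOneCocycles (W.torsionGaloisModule (2 : ℤ)).toTopRep)
    (hφ₀ : ∃ ν ∈ (galoisRepTorsion W 2).ker ⊓ κ.kerSubgroup, φ₀.1 ν ≠ 0)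
    (hψ₀ : ∃ ν ∈ (galoisRepTorsion W 2).ker ⊓ κ.kerSubgroup, ψ₀.1 ν ≠ 0)
    (eW : geomTorsion W (2 : ℤ) → geomTorsion W (2 : ℤ) → AlgebraicClosure ℚ)
    (hμ : ∀ S T, eW S T ^ 2 = 1)
    (hadd₁ : ∀ S₁ S₂ T, eW (S₁ + S₂) T = eW S₁ T * eW S₂ T)
    (hadd₂ : ∀ S T₁ T₂, eW S (T₁ + T₂) = eW S T₁ * eW S T₂)
    (halt : ∀ T, eW T T = 1) (hnondeg : ∀ T, (∀ S, eW S T = 1) → T = 0)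
    (S : Set (HeightOneSpectrum (𝓞 ℚ))) (hS : S.Finite) (n : ℕ) :
    ∃ q : HeightOneSpectrum (𝓞 ℚ), q ∉ S ∧ ∃ 𝔓 ∈ q.primesAbove, ∃ Fr : absoluteGaloisGroup ℚ,
      IsArithFrobAt (𝓞 ℚ) Fr 𝔓 ∧ galoisRepTorsion W 2 Fr ≠ 1 ∧ galoisRepTorsion W 2 (Fr * Fr) = 1 ∧
      Fr ∈ κ.layerSubgroup n ∧ Fr ∈ rootsOfUnityFixer ℚ 4 ∧
      weilPairingHom W 2 eW hμ hadd₁ hadd₂ (Fr • φ₀.1 Fr - φ₀.1 Fr) (ψ₀.1 Fr) ≠ 0 := by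
  haveI : NeZero ((4 : ℕ) : ℚ) := ⟨by norm_num⟩
  haveI hFn : (rootsOfUnityFixer ℚ 4).Normal := normal_rootsOfUnityFixer_four
  have hFo : IsOpen (rootsOfUnityFixer ℚ 4 : Set (absoluteGaloisGroup ℚ)) := isOpen_rootsOfUnityFixer ℚ 4
  -- irreducibility of `E[2]` (from surjectivity)
  have hirr : ∀ B : AddSubgroup (geomTorsion W (2 : ℤ)),
      (∀ g : absoluteGaloisGroup ℚ, ∀ x ∈ B, g • x ∈ B) → B = ⊥ ∨ B = ⊤ :=
    hasIrreducibleModPGaloisRep_of_hasSurjectiveModNGaloisRep W 2 h2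
  -- `τ` is a transposition in `ker κ`: `τ² = 1` on `E[2]`, a moved point, the fixed line; a 3-cycle in `ker κ`
  have hττ : ∀ P : geomTorsion W 2, (τ * τ) • P = P :=
    (forall_smul_eq_iff_permGal_eq_one W (τ * τ)).mpr
      (by rw [permGal_mul]; exact perm_fin_three_mul_self_of_sign_eq_neg_one' _ hsign)
  have hne1 : permGal W two_ne_zero τ ≠ 1 := by
    intro h
    rw [h, Equiv.Perm.sign_one] at hsign
    exact absurd hsign (by decide)
  obtain ⟨x₀, hx₀⟩ : ∃ P : geomTorsion W 2, τ • P ≠ P := by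
    by_contra h
    push Not at h
    exact hne1 ((forall_smul_eq_iff_permGal_eq_one W τ).mp h)
  obtain ⟨P, hP0, hcP, hℓ, -⟩ := exists_fixedPoint_of_sign_permGal_eq_neg_one W hsign
  have hρc : galoisRepTorsion W 2 τ ≠ 1 := fun h =>
    hx₀ ((mem_ker_galoisRepTorsion_two_iff W τ).mp (MonoidHom.mem_ker.mpr h) x₀)
  obtain ⟨σ₀, hσ₀κ, hσ₀⟩ := exists_mem_kerSubgroup_forall_smul_ne W κ h2 hτκ hsign
  -- `L = Gal(ℚ̄/ℚ_n) ⊓ Gal(ℚ̄/ℚ(i))`: open, normal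
  set L : Subgroup (absoluteGaloisGroup ℚ) := κ.layerSubgroup n ⊓ rootsOfUnityFixer ℚ 4 with hL
  haveI hLn : L.Normal := Subgroup.normal_inf_normal _ _
  have hLo : IsOpen (L : Set (absoluteGaloisGroup ℚ)) := (κ.isOpen_layerSubgroup n).inter hFo
  -- `G = ker ρ̄₂ ⊓ L`: open, normal, acts trivially on `E[2]`
  set G : Subgroup (absoluteGaloisGroup ℚ) := (galoisRepTorsion W 2).ker ⊓ L with hG
  haveI hGn : G.Normal := Subgroup.normal_inf_normal _ _
  have hGV : ∀ σ ∈ G, ∀ x : (W.torsionGaloisModule (2 : ℤ)).toTopRep,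
      (W.torsionGaloisModule (2 : ℤ)).toTopRep.ρ σ x = x :=
    fun σ hσ x => (mem_ker_galoisRepTorsion_two_iff W σ).mp (Subgroup.mem_inf.mp hσ).1 x
  have hGo : IsOpen (G : Set (absoluteGaloisGroup ℚ)) :=
    (W.isOpen_ker_galoisRepTorsion_holds (n := (2 : ℤ)) two_ne_zero).inter hLo
  have hNG : (galoisRepTorsion W 2).ker ⊓ κ.kerSubgroup ⊓ rootsOfUnityFixer ℚ 4 ≤ G := by
    intro x hx
    obtain ⟨⟨hx1, hx2⟩, hx3⟩ := Subgroup.mem_inf.mp hx |>.imp_left Subgroup.mem_inf.mp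
    exact Subgroup.mem_inf.mpr ⟨hx1, Subgroup.mem_inf.mpr ⟨κ.kerSubgroup_le_layerSubgroup n hx2, hx3⟩⟩
  -- the joint values `A = (φ₀, ψ₀)(G)`, supplied by the index-2 descent
  set A := contOneCocycles.jointValueSubgroup φ₀ ψ₀ G hGV hGV with hA
  have hAst : ∀ g : absoluteGaloisGroup ℚ, ∀ z ∈ A, (g • z.1, g • z.2) ∈ A :=
    fun g z hz => contOneCocycles.smul_mem_jointValueSubgroup φ₀ ψ₀ G hGV hGV g hz
  obtain ⟨ν₁, hν₁, hφν₁⟩ := exists_mem_inf_rootsOfUnityFixer_four_apply_ne_zero W κ h2 hτκ hsign φ₀ hφ₀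
  obtain ⟨ν₂, hν₂, hψν₂⟩ := exists_mem_inf_rootsOfUnityFixer_four_apply_ne_zero W κ h2 hτκ hsign ψ₀ hψ₀
  have hA1 : ∃ z ∈ A, z.1 ≠ 0 := ⟨(φ₀.1 ν₁, ψ₀.1 ν₁), ⟨ν₁, hNG hν₁, rfl⟩, hφν₁⟩
  have hA2 : ∃ z ∈ A, z.2 ≠ 0 := ⟨(φ₀.1 ν₂, ψ₀.1 ν₂), ⟨ν₂, hNG hν₂, rfl⟩, hψν₂⟩
  -- in the diagonal case `φ₀(τ) − ψ₀(τ) ∈ ℓ_τ` (Sah for `φ₀ − ψ₀` on the FULL `ker ρ̄₂ ⊓ ker κ`)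
  have hNG' : (galoisRepTorsion W 2).ker ⊓ κ.kerSubgroup ⊓ rootsOfUnityFixer ℚ 4 ≤
      (galoisRepTorsion W 2).ker ⊓ κ.kerSubgroup := inf_le_left
  have hdiag : (∀ z ∈ A, z.1 = z.2) → τ • (φ₀.1 τ - ψ₀.1 τ) = φ₀.1 τ - ψ₀.1 τ := by
    intro hd
    -- `φ₀ − ψ₀` vanishes on `ker ρ̄₂ ⊓ ker κ ⊓ Gal(ℚ̄/ℚ(i))`, hence (index-2 descent, contrapositive) on `ker ρ̄₂ ⊓ ker κ`
    have hd' : ∀ ν ∈ (galoisRepTorsion W 2).ker ⊓ κ.kerSubgroup, (φ₀ - ψ₀).1 ν = 0 := by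
      by_contra hne
      push Not at hne
      obtain ⟨ν, hν, hνne⟩ :=
        exists_mem_inf_rootsOfUnityFixer_four_apply_ne_zero W κ h2 hτκ hsign (φ₀ - ψ₀) hne
      have := hd (φ₀.1 ν, ψ₀.1 ν) ⟨ν, hNG hν, rfl⟩
      exact hνne (by change φ₀.1 ν - ψ₀.1 ν = 0; exact sub_eq_zero.mpr this)
    have h0 : oneCocycleClass _ (φ₀ - ψ₀) = 0 :=
      torsion_two_oneCocycleClass_eq_zero_of_forall_mem_eq_zero_of_noFixedPoint W κ hσ₀κ hσ₀ (φ₀ - ψ₀) hd'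
    obtain ⟨w, hw⟩ := (oneCocycleClass_eq_zero_iff _ _).mp h0
    have hwc : φ₀.1 τ - ψ₀.1 τ = τ • w - w := hw τ
    rw [hwc, smul_sub, ← mul_smul, hττ w, ← neg_sub (τ • w) w]
    exact neg_eq_self_geomTorsion_two W _
  -- the joint value `(φ₀ a, ψ₀ a)`, `a ∈ G`
  obtain ⟨z, hzA, hz1, hz2⟩ := exists_mem_stableProd_smul_add_ne hirr hP0 hcP hℓ A hAst hA1 hA2
    (φ₀.1 τ) (ψ₀.1 τ) hdiag hx₀
  obtain ⟨a, haG, rfl⟩ := hzA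
  dsimp only at hz1 hz2
  -- `σ := a τ ∈ L`
  have haρ : a ∈ (galoisRepTorsion W 2).ker := (Subgroup.mem_inf.mp haG).1
  have hτL : τ ∈ L := Subgroup.mem_inf.mpr ⟨κ.kerSubgroup_le_layerSubgroup n hτκ, hτ4⟩
  have hσn : a * τ ∈ L := L.mul_mem (Subgroup.mem_inf.mp haG).2 hτL
  have hρσ : galoisRepTorsion W 2 (a * τ) = galoisRepTorsion W 2 τ := by
    rw [map_mul, MonoidHom.mem_ker.mp haρ, one_mul]
  have hφσ : φ₀.1 (a * τ) = φ₀.1 a + φ₀.1 τ := contOneCocycles.apply_mul_of_fixed φ₀ (hGV a haG) τ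
  have hψσ : ψ₀.1 (a * τ) = ψ₀.1 a + ψ₀.1 τ := contOneCocycles.apply_mul_of_fixed ψ₀ (hGV a haG) τ
  have hσx : ∀ x : geomTorsion W (2 : ℤ), (a * τ) • x = τ • x := fun x => by
    rw [mul_smul, (mem_ker_galoisRepTorsion_two_iff W a).mp haρ]
  -- the open normal subgroup `N = {g ∈ G ∩ L : φ₀ g = ψ₀ g = 0}`
  obtain ⟨N, hNn, hNo, hNK, hNL, hNφ, hNψ⟩ :=
    JointValue.exists_normal_isOpen_le_forall_apply_eq_zero φ₀ ψ₀ G hGV hGV hGo L hLo (isOpen_discrete _)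
      (isOpen_discrete _)
  haveI := hNn
  -- Chebotarev at the class of `σ`
  obtain ⟨q, hqS, -, 𝔓, h𝔓, Fr, hFr, hFrσ⟩ :=
    exists_isArithFrobAt_mul_inv_mem_not_mem ℚ N hNo (a * τ) S hS
  -- transport along the coset `Fr = ν σ`, `ν ∈ N`
  have hνG : Fr * (a * τ)⁻¹ ∈ G := hNK hFrσ
  have hFrν : Fr = Fr * (a * τ)⁻¹ * (a * τ) := by rw [inv_mul_cancel_right]
  have hρFr : galoisRepTorsion W 2 Fr = galoisRepTorsion W 2 τ := by
    rw [hFrν, map_mul, MonoidHom.mem_ker.mp (Subgroup.mem_inf.mp hνG).1, one_mul, hρσ]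
  have hφFr : φ₀.1 Fr = φ₀.1 (a * τ) := by
    rw [hFrν, contOneCocycles.apply_mul_of_fixed φ₀ (hGV _ hνG) (a * τ), hNφ _ hFrσ, zero_add]
  have hψFr : ψ₀.1 Fr = ψ₀.1 (a * τ) := by
    rw [hFrν, contOneCocycles.apply_mul_of_fixed ψ₀ (hGV _ hνG) (a * τ), hNψ _ hFrσ, zero_add]
  have hFrx : ∀ x : geomTorsion W (2 : ℤ), Fr • x = τ • x := fun x => by
    rw [hFrν, mul_smul, hσx]
    exact (mem_ker_galoisRepTorsion_two_iff W _).mp (Subgroup.mem_inf.mp hνG).1 (τ • x)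
  have hτ1 : galoisRepTorsion W 2 (τ * τ) = 1 :=
    MonoidHom.mem_ker.mp ((mem_ker_galoisRepTorsion_two_iff W (τ * τ)).mpr hττ)
  have hFrL : Fr ∈ L := by
    rw [hFrν]
    exact L.mul_mem (hNL hFrσ) hσn
  refine ⟨q, hqS, 𝔓, h𝔓, Fr, hFr, ?_, ?_, (Subgroup.mem_inf.mp hFrL).1, (Subgroup.mem_inf.mp hFrL).2, ?_⟩
  · rw [hρFr]
    exact hρc
  · rw [map_mul, hρFr, ← map_mul, hτ1]
  · rw [hφFr, hψFr, hFrx, hφσ, hψσ]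
    exact weilPairingHom_two_smul_sub_ne_zero W eW hμ hadd₁ hadd₂ halt hnondeg hsign hz1 hz2

end Main

/-! ## §4 (H-C)⁺: `ChebotarevTranspositionTwo` on `0 < Δ` with the extra conjunct `4 ∣ ℓ(q) − 1` -/

/-- **(H-C)⁺ — the transposition prime `q ≡ 1 (mod 4)` on the habitat of CoreA⁺.** The displayed statement
`ChebotarevTranspositionTwo` (`…OmegaRoadDefs` §2) with its binder `W.Δ < 0` REPLACED by
`W.HasGoodReductionAtPrime 2 → 0 < W.Δ`, and with ONE MORE OUTPUT CONJUNCT `4 ∣ ((primesEquiv q : Nat.Primes) : ℕ) - 1`: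
for `W` globally minimal with good reduction at `2`, `0 < Δ`, `ρ̄_{W,2}` onto and `κ` cyclotomic, every admissible
`(κ', φ, ψ, e, S, n)` has a Chebotarev prime `q ∉ S`, `q ≡ 1 (mod 4)`, whose Frobenius is a transposition on `E[2]` of
depth `≥ n` with non-degenerate bottom pairing. Rubin's `τ` (p682874: `τ ∈ ker κ`, transposition, `τ • i = i`; its
hypotheses `2Δ, −Δ, −2Δ ∉ ℚ^{×2}` follow from good reduction at `2` and `0 < Δ`) is fed to §3, and `Fr ∈ Gal(ℚ̄/ℚ(i))` is
converted by §1 (`q ∤ 2` by enlarging `S` with the primes above `2`). This is the (H-C) input of the `0 < Δ` twin of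
`stub_port_of_rankOne`, matching a (H-K)⁺ with the extra hypothesis `4 ∣ ℓ(q) − 1` on its prime `q`.
[cite: MazurRubin2004, §3.6 and Prop. 1.3.2] [cite: Rubin2000, §2.1 (Hyp(K_∞, T) (b))] -/
theorem chebotarevTransposition_two_posDisc :
    ∀ (W : WeierstrassCurve ℚ) [W.IsElliptic] [W.IsGloballyMinimal] (κ : ZpExtension ℚ 2)
      (γ : absoluteGaloisGroup ℚ),
      W.HasSurjectiveModNGaloisRep 2 → W.HasGoodReductionAtPrime 2 → 0 < W.Δ → κ.IsCyclotomic →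
      κ.IsTopGenerator γ →
      ∀ (κ' : κ.twistTower (W.torsionGaloisModule (2 : ℤ))
          (fun P : WeierstrassCurve.geomTorsion W (2 : ℤ) => AddSubgroup.torsionBy.nsmul P)),
        κ.towerConst (W.torsionGaloisModule (2 : ℤ)) (fun P => AddSubgroup.torsionBy.nsmul P) κ' ≠ 0 →
      ∀ (J : ℕ) (φ : contOneCocycles (W.modPTwist 2 κ (J + 1)).toTopRep),
        oneCocycleClass (W.modPTwist 2 κ (J + 1)).toTopRep φ = κ'.1 (J + 1) →
      ∀ (ψ : contOneCocycles (W.modPTwist 2 κ.invTwist (J + 1)).toTopRep),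
        (κ.invTwist.shiftH1 (W.torsionGaloisModule (2 : ℤ))
            (fun P : WeierstrassCurve.geomTorsion W (2 : ℤ) => AddSubgroup.torsionBy.nsmul P) (J + 1))^[J]
          (oneCocycleClass (W.modPTwist 2 κ.invTwist (J + 1)).toTopRep ψ) ≠ 0 →
      ∀ (eW : WeierstrassCurve.geomTorsion W (2 : ℤ) → WeierstrassCurve.geomTorsion W (2 : ℤ) →
          AlgebraicClosure ℚ)
        (hμ : ∀ S T, eW S T ^ 2 = 1)
        (hadd₁ : ∀ S₁' S₂' T, eW (S₁' + S₂') T = eW S₁' T * eW S₂' T)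
        (hadd₂ : ∀ S T₁ T₂, eW S (T₁ + T₂) = eW S T₁ * eW S T₂),
        (∀ T, eW T T = 1) → (∀ T, (∀ S, eW S T = 1) → T = 0) →
        (∀ (σ : absoluteGaloisGroup ℚ) (S T : WeierstrassCurve.geomTorsion W (2 : ℤ)),
          σ • eW S T = eW (σ • S) (σ • T)) →
      ∀ (S : Set (HeightOneSpectrum (𝓞 ℚ))), S.Finite → ∀ (n : ℕ),
      ∃ q : HeightOneSpectrum (𝓞 ℚ), q ∉ S ∧ ∃ 𝔓 ∈ q.primesAbove, ∃ Fr : absoluteGaloisGroup ℚ,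
        IsArithFrobAt (𝓞 ℚ) Fr 𝔓 ∧
        WeierstrassCurve.galoisRepTorsion W 2 Fr ≠ 1 ∧ WeierstrassCurve.galoisRepTorsion W 2 (Fr * Fr) = 1 ∧
        Fr ∈ κ.layerSubgroup n ∧ 4 ∣ ((primesEquiv q : Nat.Primes) : ℕ) - 1 ∧
        weilPairingHom W 2 eW hμ hadd₁ hadd₂ (Fr • φ.1 Fr ⟨0, Nat.succ_pos J⟩ - φ.1 Fr ⟨0, Nat.succ_pos J⟩)
          (ψ.1 Fr ⟨0, Nat.succ_pos J⟩) ≠ 0 := by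
  intro W _ _ κ _ h2 hgood hΔ hκ _ κ' hκ' J φ hφ ψ hψ eW hμ hadd₁ hadd₂ halt hnondeg _ S hS n
  -- the sign-free square conditions on the habitat
  obtain ⟨h2Δ, hn2Δ⟩ := not_isSquare_two_mul_Δ_of_good_two W hgood
  have hnΔ : ¬ IsSquare (-W.Δ) := by
    rintro ⟨r, hr⟩
    nlinarith [mul_self_nonneg r]
  -- Rubin's `τ`: in `ker κ`, a transposition on `E[2]`, fixing `i`
  obtain ⟨i, hi⟩ := IsAlgClosed.exists_eq_mul_self (-1 : AlgebraicClosure ℚ)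
  have hi' : i ^ 2 = -1 := by rw [pow_two]; exact hi.symm
  obtain ⟨τ, hτκ, hsign, hτi⟩ :=
    exists_mem_kerSubgroup_transposition_smul_sqrt_neg_one_eq W κ hκ h2 h2Δ hnΔ hn2Δ hi'
  have hτ4 : τ ∈ rootsOfUnityFixer ℚ 4 := mem_rootsOfUnityFixer_four_of_smul_eq hi' hτi
  -- enlarge `S` by the primes above `2`
  set S₂ : Set (HeightOneSpectrum (𝓞 ℚ)) := {v | ((2 : ℕ) : 𝓞 ℚ) ∈ v.asIdeal} with hS₂
  have hS₂fin : S₂.Finite := by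
    refine (Ideal.finite_factors (I := Ideal.span {((2 : ℕ) : 𝓞 ℚ)}) ?_).subset fun v hv => ?_
    · rw [Ne, Ideal.zero_eq_bot, Ideal.span_singleton_eq_bot]
      exact two_ne_zero
    · exact (Ideal.dvd_span_singleton).mpr hv
  obtain ⟨q, hq, 𝔓, h𝔓, Fr, hFr, hρ1, hρ2, hFrn, hFr4, hne⟩ :=
    exists_isArithFrobAt_transposition_weilPairingHom_ne_zero_mod_four_of_mem_kerSubgroup W κ h2 hτκ hsign hτ4 _ _
      (exists_mem_constCoeff_apply_ne_zero_of_towerConst_ne_zero_of_isCyclotomic W κ hκ h2 h2Δ κ' hκ' J φ hφ)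
      (exists_mem_constCoeff_apply_ne_zero_of_shiftH1_iterate_ne_zero_of_isCyclotomic W κ hκ h2 h2Δ J ψ hψ)
      eW hμ hadd₁ hadd₂ halt hnondeg (S ∪ S₂) (hS.union hS₂fin) n
  have hqS : q ∉ S := fun h => hq (Or.inl h)
  have hq2 : ((2 : ℕ) : 𝓞 ℚ) ∉ q.asIdeal := fun h => hq (Or.inr h)
  exact ⟨q, hqS, 𝔓, h𝔓, Fr, hFr, hρ1, hρ2, hFrn,
    four_dvd_primesEquiv_sub_one_of_mem_rootsOfUnityFixer_four hq2 h𝔓 hFr hFr4, hne⟩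

end Summit.BirchSwinnertonDyer.BirchSwinnertonDyer.Theorems.SteinbergFibreAtTwo

end
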